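import Mathlib
import Summits.CriticalPhenomena.CardyFormulaZ2.Theorems.CardySelfRefinementDefs
import Summits.CriticalPhenomena.CardyFormulaZ2.Theorems.CardySelfRefinementTrivialSectorRateStubLocalEngineRotation
import Summits.CriticalPhenomena.CardyFormulaZ2.Theorems.CardySelfRefinementTrivialSectorRateStubLocalEngineRotationCoins
import Summits.CriticalPhenomena.CardyFormulaZ2.Theorems.CardySelfRefinementTrivialSectorRateStubRussoOrbit
import Literature.Probability.Percolation.SelfRefinementMeasure
import HarnessLib

/-!
# Stub `stub_localEngine` of line `far-field-is-a-quarter-turn` (crux `TrivialSectorRate`,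
stmt-CriticalPhenomena-10266): the quarter turn generates a `C₄`-ACTION — order four and the orbits

Companion of `…StubLocalEngineRotation[Coins|Cond|Window].lean` (the quarter turn `g` about the
block centre `ctr k u = k•u` and its coin permutation `σ`, pinned down by their formulas `hg`,
`h0` (own coins), `h` (shared coins and selectors)).  Here the group structure behind the engine's
orbit sums is made explicit:

* **Order four.**  `g (g x) = 2c − x` is the half turn (`quarterTurn_apply_apply`) and
  `g (g (g (g x))) = x` (`quarterTurn_apply_four`), so `g⁻¹ = g³` (`quarterTurn_symm_eq_apply_three`);
  likewise `σ (σ i)` is the coin of the point-reflected edge / bundle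
  (`quarterTurn_coin_apply_apply_zero/_ne_zero`), `σ (σ (σ (σ i))) = i` (`quarterTurn_coin_apply_four`,
  registered) and `σ⁻¹ = σ³` (`quarterTurn_coin_symm_eq_apply_three`); hence the IMAGE of an event /
  coin set under the turn is its triple pull-back (`preimage_relabel_quarterTurn_symm`,
  `preimage_quarterTurn_coin_symm`).
* **The selector / shared coins of the four bundles at `u` form ONE `σ`-cycle**: starting from the
  east bundle `(u, 0)`, `σ` visits south `(u − e₁, 1)`, west `(u − e₀, 0)`, north `(u, 1)` and comes
  back (`quarterTurn_coin_east_orbit`); hence every sum over `bundlesAt u` is the sum over the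
  `σ`-orbit of the east coin (`sum_bundlesAt_eq_orbit`, registered).
* **The own coins of the interior edges of the four cells at `u` are permuted along the cell
  cycle**: the edge part of `σ` maps the interior edges of ANY cell `t` ONTO those of the rotated
  cell `(t₁ − u₁ + u₀, u₀ + u₁ − t₀ − 1)` (`image_quarterTurn_interiorEdges`,
  `sum_interiorEdges_quarterTurn_cell`), the four cells at `u` are visited in the order
  `u ↦ u − e₁ ↦ u − e₀ − e₁ ↦ u − e₀ ↦ u` (`quarterTurn_cell_cellsAt`), hence every double sum over
  the interior edges of `cellsAt u` is the sum over the interior edges `e` of the north-east cell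
  `u` of the sum over the `σ`-orbit of `(e, 0)` (`sum_cellsAt_interiorEdges_eq_orbit`, registered).
-/

noncomputable section

namespace Summit.CriticalPhenomena.CardyFormulaZ2.Theorems.CardySelfRefinement.FarField

open Set MeasureTheory
open Literature.Probability.LatticeModels Literature.Probability.Percolation
open Literature.Probability.Percolation.QuadCrossing
open Summit.CriticalPhenomena.CardyFormulaZ2.Theses.CardySelfRefinement

/-! ### The quarter turn has order four -/

/-- **The half turn**: `g (g x) = 2c − x`, the point reflection in the block centre `c = ctr k u`. -/
theorem quarterTurn_apply_apply {k : ℕ} {u : Site 2} (g : Site 2 ≃ Site 2)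
    (hg : ∀ x, g x = ![ctr k u 0 + ctr k u 1 - x 1, x 0 - ctr k u 0 + ctr k u 1]) (x : Site 2) :
    g (g x) = ![2 * ctr k u 0 - x 0, 2 * ctr k u 1 - x 1] := by
  rw [hg, hg]
  funext i
  fin_cases i <;> simp <;> ring

/-- **The quarter turn has order four**: `g (g (g (g x))) = x`. -/
theorem quarterTurn_apply_four {k : ℕ} {u : Site 2} (g : Site 2 ≃ Site 2)
    (hg : ∀ x, g x = ![ctr k u 0 + ctr k u 1 - x 1, x 0 - ctr k u 0 + ctr k u 1]) (x : Site 2) :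
    g (g (g (g x))) = x := by
  rw [quarterTurn_apply_apply g hg, quarterTurn_apply_apply g hg]
  funext i
  fin_cases i <;> simp

/-- Hence the inverse quarter turn is the cube: `g⁻¹ x = g (g (g x))`. -/
theorem quarterTurn_symm_eq_apply_three {k : ℕ} {u : Site 2} (g : Site 2 ≃ Site 2)
    (hg : ∀ x, g x = ![ctr k u 0 + ctr k u 1 - x 1, x 0 - ctr k u 0 + ctr k u 1]) (x : Site 2) :
    g.symm x = g (g (g x)) := by
  rw [Equiv.symm_apply_eq]
  exact (quarterTurn_apply_four g hg x).symm

/-- As a permutation: `g ^ 4 = 1`. -/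
theorem quarterTurn_pow_four {k : ℕ} {u : Site 2} (g : Site 2 ≃ Site 2)
    (hg : ∀ x, g x = ![ctr k u 0 + ctr k u 1 - x 1, x 0 - ctr k u 0 + ctr k u 1]) :
    g ^ 4 = 1 := by
  ext x : 1
  simp only [Equiv.Perm.coe_pow, Function.iterate_succ, Function.iterate_zero, Function.comp_apply,
    CompTriple.comp_eq, Equiv.Perm.coe_one, id_eq]
  exact quarterTurn_apply_four g hg x

/-! ### The coin permutation has order four -/

/-- `σ (σ (v,d,0))` is the own coin of the point-reflected edge:
`((2c₀ − v₀ − [d = 0], 2c₁ − v₁ − [d = 1]), d, 0)`. -/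
theorem quarterTurn_coin_apply_apply_zero {k : ℕ} {u : Site 2} (σ : Coin ≃ Coin)
    (h0 : ∀ (v : Site 2) (d : Fin 2), σ (v, d, 0) =
      (![v 1 - ctr k u 1 + ctr k u 0, ctr k u 0 + ctr k u 1 - v 0 - (if d = 0 then 1 else 0)],
        Equiv.swap 0 1 d, 0)) (v : Site 2) (d : Fin 2) :
    σ (σ (v, d, 0)) =
      (![2 * ctr k u 0 - v 0 - (if d = 0 then 1 else 0), 2 * ctr k u 1 - v 1 - (if d = 1 then 1 else 0)],
        d, 0) := by
  rw [h0, h0]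
  simp only [Prod.mk.injEq, and_true]
  refine ⟨?_, ?_⟩
  · funext i
    fin_cases i <;> fin_cases d <;> simp <;> ring
  · fin_cases d <;> rfl

/-- `σ (σ (t,d,j))` (`j ≠ 0`) is the same coin of the point-reflected bundle:
`((2u₀ − t₀ − [d = 0], 2u₁ − t₁ − [d = 1]), d, j)`. -/
theorem quarterTurn_coin_apply_apply_ne_zero {u : Site 2} (σ : Coin ≃ Coin)
    (h : ∀ (t : Site 2) (d : Fin 2) (j : Fin 3), j ≠ 0 → σ (t, d, j) =
      (![t 1 - u 1 + u 0, u 0 + u 1 - t 0 - (if d = 0 then 1 else 0)], Equiv.swap 0 1 d, j))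
    (t : Site 2) (d : Fin 2) {j : Fin 3} (hj : j ≠ 0) :
    σ (σ (t, d, j)) =
      (![2 * u 0 - t 0 - (if d = 0 then 1 else 0), 2 * u 1 - t 1 - (if d = 1 then 1 else 0)], d, j) := by
  rw [h _ _ _ hj, h _ _ _ hj]
  simp only [Prod.mk.injEq, and_true]
  refine ⟨?_, ?_⟩
  · funext i
    fin_cases i <;> fin_cases d <;> simp <;> ring
  · fin_cases d <;> rfl

/-- **The coin permutation of the quarter turn has order four**: `σ (σ (σ (σ i))) = i` for every
coin `i` (own coins by `h0`, shared coins and selectors by `h`). -/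
theorem quarterTurn_coin_apply_four {k : ℕ} {u : Site 2} (σ : Coin ≃ Coin)
    (h0 : ∀ (v : Site 2) (d : Fin 2), σ (v, d, 0) =
      (![v 1 - ctr k u 1 + ctr k u 0, ctr k u 0 + ctr k u 1 - v 0 - (if d = 0 then 1 else 0)],
        Equiv.swap 0 1 d, 0))
    (h : ∀ (t : Site 2) (d : Fin 2) (j : Fin 3), j ≠ 0 → σ (t, d, j) =
      (![t 1 - u 1 + u 0, u 0 + u 1 - t 0 - (if d = 0 then 1 else 0)], Equiv.swap 0 1 d, j))
    (i : Coin) : σ (σ (σ (σ i))) = i := by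
  obtain ⟨v, d, j⟩ := i
  by_cases hj : j = 0
  · subst hj
    rw [quarterTurn_coin_apply_apply_zero σ h0, quarterTurn_coin_apply_apply_zero σ h0]
    simp only [Prod.mk.injEq, and_true]
    funext i
    fin_cases i <;> fin_cases d <;> simp <;> ring
  · rw [quarterTurn_coin_apply_apply_ne_zero σ h _ _ hj, quarterTurn_coin_apply_apply_ne_zero σ h _ _ hj]
    simp only [Prod.mk.injEq, and_true]
    funext i
    fin_cases i <;> fin_cases d <;> simp <;> ring

/-- Hence the inverse coin permutation is the cube: `σ⁻¹ i = σ (σ (σ i))`. -/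
theorem quarterTurn_coin_symm_eq_apply_three {k : ℕ} {u : Site 2} (σ : Coin ≃ Coin)
    (h0 : ∀ (v : Site 2) (d : Fin 2), σ (v, d, 0) =
      (![v 1 - ctr k u 1 + ctr k u 0, ctr k u 0 + ctr k u 1 - v 0 - (if d = 0 then 1 else 0)],
        Equiv.swap 0 1 d, 0))
    (h : ∀ (t : Site 2) (d : Fin 2) (j : Fin 3), j ≠ 0 → σ (t, d, j) =
      (![t 1 - u 1 + u 0, u 0 + u 1 - t 0 - (if d = 0 then 1 else 0)], Equiv.swap 0 1 d, j))
    (i : Coin) : σ.symm i = σ (σ (σ i)) := by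
  rw [Equiv.symm_apply_eq]
  exact (quarterTurn_coin_apply_four σ h0 h i).symm

/-- As a permutation: `σ ^ 4 = 1`. -/
theorem quarterTurn_coin_pow_four {k : ℕ} {u : Site 2} (σ : Coin ≃ Coin)
    (h0 : ∀ (v : Site 2) (d : Fin 2), σ (v, d, 0) =
      (![v 1 - ctr k u 1 + ctr k u 0, ctr k u 0 + ctr k u 1 - v 0 - (if d = 0 then 1 else 0)],
        Equiv.swap 0 1 d, 0))
    (h : ∀ (t : Site 2) (d : Fin 2) (j : Fin 3), j ≠ 0 → σ (t, d, j) =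
      (![t 1 - u 1 + u 0, u 0 + u 1 - t 0 - (if d = 0 then 1 else 0)], Equiv.swap 0 1 d, j)) :
    σ ^ 4 = 1 := by
  ext i : 1
  simp only [Equiv.Perm.coe_pow, Function.iterate_succ, Function.iterate_zero, Function.comp_apply,
    CompTriple.comp_eq, Equiv.Perm.coe_one, id_eq]
  exact quarterTurn_coin_apply_four σ h0 h i

/-! ### Consequently inverse images are triple forward images -/

/-- `g⁻¹ = g ∘ g ∘ g` as bijections. -/
theorem quarterTurn_symm_eq_trans {k : ℕ} {u : Site 2} (g : Site 2 ≃ Site 2)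
    (hg : ∀ x, g x = ![ctr k u 0 + ctr k u 1 - x 1, x 0 - ctr k u 0 + ctr k u 1]) :
    g.symm = (g.trans g).trans g :=
  Equiv.ext fun x => by rw [quarterTurn_symm_eq_apply_three g hg]; rfl

/-- Relabelling along `g⁻¹` is relabelling along `g` three times. -/
theorem relabel_quarterTurn_symm {k : ℕ} {u : Site 2} (g : Site 2 ≃ Site 2)
    (hg : ∀ x, g x = ![ctr k u 0 + ctr k u 1 - x 1, x 0 - ctr k u 0 + ctr k u 1])
    (ω : BondConfig (Site 2)) :
    BondConfig.relabel (sym2Equiv g.symm) ω =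
      BondConfig.relabel (sym2Equiv g) (BondConfig.relabel (sym2Equiv g)
        (BondConfig.relabel (sym2Equiv g) ω)) := by
  rw [quarterTurn_symm_eq_trans g hg, relabel_sym2Equiv_trans, relabel_sym2Equiv_trans]

/-- **The `g`-image of an event is its triple `g`-pull-back**:
`{ω | g⁻¹ '' ω ∈ B} = {ω | g '' (g '' (g '' ω)) ∈ B}`. -/
theorem preimage_relabel_quarterTurn_symm {k : ℕ} {u : Site 2} (g : Site 2 ≃ Site 2)
    (hg : ∀ x, g x = ![ctr k u 0 + ctr k u 1 - x 1, x 0 - ctr k u 0 + ctr k u 1])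
    (B : Set (BondConfig (Site 2))) :
    BondConfig.relabel (sym2Equiv g.symm) ⁻¹' B =
      BondConfig.relabel (sym2Equiv g) ⁻¹' (BondConfig.relabel (sym2Equiv g) ⁻¹'
        (BondConfig.relabel (sym2Equiv g) ⁻¹' B)) := by
  ext ω
  simp only [Set.mem_preimage, relabel_quarterTurn_symm g hg]

/-- **The `σ`-image of a coin set is its triple `σ`-pull-back**: `σ.symm ⁻¹' S = σ ⁻¹' (σ ⁻¹' (σ ⁻¹' S))`. -/
theorem preimage_quarterTurn_coin_symm {k : ℕ} {u : Site 2} (σ : Coin ≃ Coin)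
    (h0 : ∀ (v : Site 2) (d : Fin 2), σ (v, d, 0) =
      (![v 1 - ctr k u 1 + ctr k u 0, ctr k u 0 + ctr k u 1 - v 0 - (if d = 0 then 1 else 0)],
        Equiv.swap 0 1 d, 0))
    (h : ∀ (t : Site 2) (d : Fin 2) (j : Fin 3), j ≠ 0 → σ (t, d, j) =
      (![t 1 - u 1 + u 0, u 0 + u 1 - t 0 - (if d = 0 then 1 else 0)], Equiv.swap 0 1 d, j))
    (S₁ : Set Coin) : σ.symm ⁻¹' S₁ = σ ⁻¹' (σ ⁻¹' (σ ⁻¹' S₁)) := by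
  ext i
  simp only [Set.mem_preimage, quarterTurn_coin_symm_eq_apply_three σ h0 h]

/-! ### The bundle coins at `u`: one `σ`-cycle through east, south, west, north -/

/-- **The `σ`-orbit of the east coin** `(u, 0, j)` (`j ≠ 0`: shared coin or selector) runs through
the four bundles at `u` in the order east `(u,0)` ↦ south `(u − e₁, 1)` ↦ west `(u − e₀, 0)` ↦
north `(u, 1)` ↦ east. -/
theorem quarterTurn_coin_east_orbit (u : Site 2) (σ : Coin ≃ Coin)
    (h : ∀ (t : Site 2) (d : Fin 2) (j : Fin 3), j ≠ 0 → σ (t, d, j) =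
      (![t 1 - u 1 + u 0, u 0 + u 1 - t 0 - (if d = 0 then 1 else 0)], Equiv.swap 0 1 d, j))
    {j : Fin 3} (hj : j ≠ 0) :
    σ (u, 0, j) = (u - Pi.single 1 1, 1, j) ∧ σ (σ (u, 0, j)) = (u - Pi.single 0 1, 0, j) ∧
      σ (σ (σ (u, 0, j))) = (u, 1, j) ∧ σ (σ (σ (σ (u, 0, j)))) = (u, 0, j) := by
  obtain ⟨h1, h2, h3, h4⟩ := quarterTurn_coin_bundlesAt u σ h hj
  rw [h1, h4, h3, h2]
  exact ⟨rfl, rfl, rfl, rfl⟩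

/-- **Sums over the bundles at `u` are sums over the `σ`-orbit of the east coin** (layer `j ≠ 0`):
`Σ_{b ∈ bundlesAt u} f (b, j) = f i₀ + f (σ i₀) + f (σ² i₀) + f (σ³ i₀)`, `i₀ = (u, 0, j)`. -/
theorem sum_bundlesAt_eq_orbit (u : Site 2) (σ : Coin ≃ Coin)
    (h : ∀ (t : Site 2) (d : Fin 2) (j : Fin 3), j ≠ 0 → σ (t, d, j) =
      (![t 1 - u 1 + u 0, u 0 + u 1 - t 0 - (if d = 0 then 1 else 0)], Equiv.swap 0 1 d, j))
    {j : Fin 3} (hj : j ≠ 0) (f : Coin → ℝ) :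
    ∑ b ∈ bundlesAt u, f (b.1, b.2, j) =
      f (u, 0, j) + f (σ (u, 0, j)) + f (σ (σ (u, 0, j))) + f (σ (σ (σ (u, 0, j)))) := by
  obtain ⟨h1, h2, h3, -⟩ := quarterTurn_coin_east_orbit u σ h hj
  rw [h3, h2, h1, sum_bundlesAt (fun b => f (b.1, b.2, j))]
  ring

/-! ### The interior edges of the cells at `u`: permuted along the cell cycle -/

/-- The cell rotation `t ↦ (t₁ − u₁ + u₀, u₀ + u₁ − t₀ − 1)` is injective. -/
theorem quarterTurn_cell_injective (u : Site 2) {t t' : Site 2}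
    (htt' : (![t 1 - u 1 + u 0, u 0 + u 1 - t 0 - 1] : Site 2) =
      ![t' 1 - u 1 + u 0, u 0 + u 1 - t' 0 - 1]) : t = t' := by
  have e0 := congrFun htt' 0
  have e1 := congrFun htt' 1
  simp only [Matrix.cons_val_zero, Matrix.cons_val_one, Matrix.cons_val_fin_one] at e0 e1
  funext i
  fin_cases i
  · simp only [Fin.zero_eta]
    omega
  · simp only [Fin.mk_one]
    omega

/-- **The edge part of `σ` maps the interior edges of ANY cell `t` ONTO the interior edges of the
rotated cell** `(t₁ − u₁ + u₀, u₀ + u₁ − t₀ − 1)` (`k > 0`; into: `tb_quarterTurn_edge`; onto: the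
pre-image of an interior edge of the rotated cell under `σ⁻¹` is an interior edge of `t`). -/
theorem image_quarterTurn_interiorEdges {k : ℕ} (hk : 0 < k) (u : Site 2) (σ : Coin ≃ Coin)
    (h0 : ∀ (v : Site 2) (d : Fin 2), σ (v, d, 0) =
      (![v 1 - ctr k u 1 + ctr k u 0, ctr k u 0 + ctr k u 1 - v 0 - (if d = 0 then 1 else 0)],
        Equiv.swap 0 1 d, 0)) (t : Site 2) :
    (interiorEdges k t).image
        (fun e : Site 2 × Fin 2 => ((σ (e.1, e.2, 0)).1, (σ (e.1, e.2, 0)).2.1)) =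
      interiorEdges k ![t 1 - u 1 + u 0, u 0 + u 1 - t 0 - 1] := by
  ext e'
  simp only [Finset.mem_image]
  constructor
  · rintro ⟨e, he, rfl⟩
    have hax : ¬ ax k e := by
      unfold interiorEdges at he
      exact (Finset.mem_filter.1 he).2
    have htb : tb k e = t := tb_eq_of_mem_interiorEdges hk he
    have hax' : ¬ ax k ((σ (e.1, e.2, 0)).1, (σ (e.1, e.2, 0)).2.1) := by
      rwa [ax_quarterTurn_edge_iff σ h0]
    have hmem := mem_interiorEdges_tb hk hax'
    rwa [tb_quarterTurn_edge hk σ h0 hax, htb] at hmem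
  · intro he'
    have hax' : ¬ ax k e' := by
      unfold interiorEdges at he'
      exact (Finset.mem_filter.1 he').2
    have htb' : tb k e' = ![t 1 - u 1 + u 0, u 0 + u 1 - t 0 - 1] := tb_eq_of_mem_interiorEdges hk he'
    -- the pre-image edge
    set e : Site 2 × Fin 2 := ((σ.symm (e'.1, e'.2, 0)).1, (σ.symm (e'.1, e'.2, 0)).2.1) with he_def
    have hσe : σ (e.1, e.2, 0) = (e'.1, e'.2, 0) := by
      rw [Equiv.apply_eq_iff_eq_symm_apply, he_def, quarterTurn_coin_symm_apply_zero σ h0]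
    have hedge : ((σ (e.1, e.2, 0)).1, (σ (e.1, e.2, 0)).2.1) = e' := by
      rw [hσe]
    have hax : ¬ ax k e := by
      rw [← ax_quarterTurn_edge_iff σ h0 e, hedge]
      exact hax'
    have htbe := tb_quarterTurn_edge hk σ h0 hax
    rw [hedge, htb'] at htbe
    have ht : tb k e = t := (quarterTurn_cell_injective u htbe).symm
    refine ⟨e, ?_, hedge⟩
    rw [← ht]
    exact mem_interiorEdges_tb hk hax

/-- **Sums over the interior edges of the rotated cell** are sums of `f ∘ σ` over the interior
edges of the cell (own coins, layer `0`; `k > 0`). -/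
theorem sum_interiorEdges_quarterTurn_cell {k : ℕ} (hk : 0 < k) (u : Site 2) (σ : Coin ≃ Coin)
    (h0 : ∀ (v : Site 2) (d : Fin 2), σ (v, d, 0) =
      (![v 1 - ctr k u 1 + ctr k u 0, ctr k u 0 + ctr k u 1 - v 0 - (if d = 0 then 1 else 0)],
        Equiv.swap 0 1 d, 0)) (t : Site 2) (f : Coin → ℝ) :
    ∑ e ∈ interiorEdges k ![t 1 - u 1 + u 0, u 0 + u 1 - t 0 - 1], f (e.1, e.2, 0) =
      ∑ e ∈ interiorEdges k t, f (σ (e.1, e.2, 0)) := by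
  rw [← image_quarterTurn_interiorEdges hk u σ h0 t,
    Finset.sum_image fun e _ e' _ hee' => quarterTurn_edge_injective σ h0 hee']
  exact Finset.sum_congr rfl fun e _ => by rw [← quarterTurn_coin_zero_eq σ h0 e]

/-- **The four cells at `u` form one cycle of the cell rotation**:
`u ↦ u − e₁ ↦ u − e₀ − e₁ ↦ u − e₀ ↦ u` (north-east, south-east, south-west, north-west). -/
theorem quarterTurn_cell_cellsAt (u : Site 2) :
    (![u 1 - u 1 + u 0, u 0 + u 1 - u 0 - 1] : Site 2) = u - Pi.single 1 1 ∧
      (![(u - Pi.single 1 1 : Site 2) 1 - u 1 + u 0, u 0 + u 1 - (u - Pi.single 1 1 : Site 2) 0 - 1] :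
          Site 2) = u - Pi.single 0 1 - Pi.single 1 1 ∧
      (![(u - Pi.single 0 1 - Pi.single 1 1 : Site 2) 1 - u 1 + u 0,
          u 0 + u 1 - (u - Pi.single 0 1 - Pi.single 1 1 : Site 2) 0 - 1] : Site 2) = u - Pi.single 0 1 ∧
      (![(u - Pi.single 0 1 : Site 2) 1 - u 1 + u 0, u 0 + u 1 - (u - Pi.single 0 1 : Site 2) 0 - 1] :
          Site 2) = u := by
  refine ⟨?_, ?_, ?_, ?_⟩
  all_goals
    funext i
    fin_cases i <;>
      simp only [Fin.isValue, Fin.zero_eta, Fin.mk_one, Matrix.cons_val_zero, Matrix.cons_val_one,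
        Matrix.cons_val_fin_one, Pi.sub_apply, Pi.single_apply, one_ne_zero, zero_ne_one,
        ↓reduceIte] <;> omega

/-- **The interior-edge sums of the three other cells at `u` are orbit sums over the north-east
cell `u`** (`k > 0`): the `σ`-images of the own coins of the interior edges of `u` are those of
`u − e₁`, their images those of `u − e₀ − e₁`, theirs those of `u − e₀`. -/
theorem sum_interiorEdges_cellsAt_eq_orbit {k : ℕ} (hk : 0 < k) (u : Site 2) (σ : Coin ≃ Coin)
    (h0 : ∀ (v : Site 2) (d : Fin 2), σ (v, d, 0) =
      (![v 1 - ctr k u 1 + ctr k u 0, ctr k u 0 + ctr k u 1 - v 0 - (if d = 0 then 1 else 0)],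
        Equiv.swap 0 1 d, 0)) (f : Coin → ℝ) :
    ∑ e ∈ interiorEdges k (u - Pi.single 1 1), f (e.1, e.2, 0) =
        ∑ e ∈ interiorEdges k u, f (σ (e.1, e.2, 0)) ∧
      ∑ e ∈ interiorEdges k (u - Pi.single 0 1 - Pi.single 1 1), f (e.1, e.2, 0) =
        ∑ e ∈ interiorEdges k u, f (σ (σ (e.1, e.2, 0))) ∧
      ∑ e ∈ interiorEdges k (u - Pi.single 0 1), f (e.1, e.2, 0) =
        ∑ e ∈ interiorEdges k u, f (σ (σ (σ (e.1, e.2, 0)))) := by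
  obtain ⟨c1, c2, c3, -⟩ := quarterTurn_cell_cellsAt u
  have A : ∀ (t : Site 2) (F : Coin → ℝ),
      ∑ e ∈ interiorEdges k ![t 1 - u 1 + u 0, u 0 + u 1 - t 0 - 1], F (e.1, e.2, 0) =
        ∑ e ∈ interiorEdges k t, F (σ (e.1, e.2, 0)) :=
    fun t F => sum_interiorEdges_quarterTurn_cell hk u σ h0 t F
  have h1 := A u f
  rw [c1] at h1
  have h2 := A (u - Pi.single 1 1) f
  rw [c2] at h2
  have h3 := A (u - Pi.single 0 1 - Pi.single 1 1) f
  rw [c3] at h3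
  have h1' := A u (fun i => f (σ i))
  rw [c1] at h1'
  have h2' := A (u - Pi.single 1 1) (fun i => f (σ i))
  rw [c2] at h2'
  have h1'' := A u (fun i => f (σ (σ i)))
  rw [c1] at h1''
  exact ⟨h1, h2.trans h1', h3.trans (h2'.trans h1'')⟩

/-- **Double sums over the interior edges of the cells at `u` are orbit sums**: summed over the
interior edges `e` of the north-east cell `u`, `f (e,0) + f (σ (e,0)) + f (σ² (e,0)) + f (σ³ (e,0))`
(`k > 0`). -/
theorem sum_cellsAt_interiorEdges_eq_orbit {k : ℕ} (hk : 0 < k) (u : Site 2) (σ : Coin ≃ Coin)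
    (h0 : ∀ (v : Site 2) (d : Fin 2), σ (v, d, 0) =
      (![v 1 - ctr k u 1 + ctr k u 0, ctr k u 0 + ctr k u 1 - v 0 - (if d = 0 then 1 else 0)],
        Equiv.swap 0 1 d, 0)) (f : Coin → ℝ) :
    ∑ t ∈ cellsAt u, ∑ e ∈ interiorEdges k t, f (e.1, e.2, 0) =
      ∑ e ∈ interiorEdges k u, f (e.1, e.2, 0) + ∑ e ∈ interiorEdges k u, f (σ (e.1, e.2, 0)) +
        ∑ e ∈ interiorEdges k u, f (σ (σ (e.1, e.2, 0))) +
          ∑ e ∈ interiorEdges k u, f (σ (σ (σ (e.1, e.2, 0)))) := by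
  obtain ⟨e1, e2, e3⟩ := sum_interiorEdges_cellsAt_eq_orbit hk u σ h0 f
  rw [sum_cellsAt (fun t => ∑ e ∈ interiorEdges k t, f (e.1, e.2, 0)) u, e1, e2, e3]
  ring

end Summit.CriticalPhenomena.CardyFormulaZ2.Theorems.CardySelfRefinement.FarField

end
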